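import Mathlib
import Literature.NumberTheory.LFunctions.Zhang2022.Section15GammaFactorSteps
import Literature.NumberTheory.LFunctions.Zhang2022.Section5VerticalShift
import HarnessLib

/-!
# Zhang (2022) §15, node Z22:§15.u008, part (α): the pointwise rewriting of `𝔨₁(s,ψ)` ON `𝔍(−α)`
# (the composition u004 ∘ u006 that the word "Hence" of tex L4033 performs), kernel-checked

Topic `Literature/NumberTheory/LFunctions/Zhang2022` (Landau–Siegel audit tree; verdict-neutral).
Y. Zhang, *Discrete mean estimates and the Landau–Siegel zero*, arXiv:2211.02515v1 (2022)
[Zhang2022LandauSiegel] — **an unrefereed manuscript under adjudication; nothing here asserts or denies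
its Theorems 1–2.** Lane ZHANG-L, WP15, leaf h15_6 (`Typed.Section15A.Eq15_6 c′ bChi`), node
`Z22:§15.u008` (§15 p. 80, tex L4017–L4033): "Assume `ψ ∈ Ψ₁` and `s ∈ 𝔍(−α)`. By (2.2) and Lemma 5.1
[u004] … by (2.4), (2.5) and the relation [u005] we have [u006] … Hence, moving the segment `𝔍(−α)` to
`𝔍(−1)` with a negligible error, we find that [u008]".

The typed split `Step15_u008a`/`Step15_u008b` (`TypedSection15ASubsteps`) takes the relative error of
u004/u006 on `𝔍(−1)`, where it is not absorbable into `o(𝔓)` (WP15 SEAM note, zl-closer-1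
2026-08-26T23:57Z, HOME/INBOX.md); the manuscript takes both relative errors ON `𝔍(−α)`. This file
proves part **(α)** of the corrected WP-internal split (α: pointwise on `𝔍(−α)`; β: mean value on
`𝔍(−α)`; γ: exact move of the reflected main term; δ: u007 on `σ = −1/2`):

* `step15_u008alpha_holds` — for every `c′` there is `C` such that for all large `D`, every real
  primitive `χ (mod D)`, every `ψ ∈ Ψ₁` and every `s ∈ 𝔍(−α)`:
  `‖𝔨₁(s,ψ) − M₁(s,ψ)‖ ≤ C·𝓛⁻¹²³·‖M₁(s,ψ)‖`, where
  `M₁(s,ψ) := τ(χ)χ(p)ψ̄(D)·(pt₀)^{−β₃}·D^{s−1}·[L(1−s−β₁,ψ̄)L(1−s−β₂,ψ̄)/L(1−s,ψ̄)]·B(s,ψ)·K(1−s−β₃,ψ̄)`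
  is spelled out inline (no new definition; `𝔨₁ = Typed.Section15A.frakk1`).

Proof = the tree's discharges `step15_u004_holds` (`‖L(s+β₁,ψ)L(s+β₂,ψ)/L(s,ψ) − (pt₀)^{−β₃}Z(s,ψ)·
L(1−s−β₁,ψ̄)L(1−s−β₂,ψ̄)/L(1−s,ψ̄)‖ ≤ C𝓛⁻¹²³‖…‖`) and `step15_u006_holds` (`‖Z(s,ψ)/Z(s,χψ) −
τ(χ)χ(p)ψ̄(D)D^{s−1}‖ ≤ 15e^{−πt}‖…‖`), the algebra `𝔨₁ = (Z(s,ψ)/Z(s,χψ))·(ratio/Z(s,ψ))·B·K`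
(`Z(s,ψ) ≠ 0` on the upper half-plane, `GammaFactor.Zfac_ne_zero`), the product rule for relative
errors, and `e^{−πt} ≤ 𝓛⁻¹²³` on `𝔍(−α)` (`t ≥ 5𝓛⁵¹⁹`, `five_mul_le_im_of_memJ`).

WHAT THIS IS NOT: the move of the segment (part γ), the mean-value bound (part β), or the display u008
itself. No claim about Landau–Siegel zeros.

## References

* Y. Zhang, arXiv:2211.02515v1 (2022), §15 p. 80, tex L4017–L4033. [cite: Zhang2022LandauSiegel, §15 p. 80]
-/

noncomputable section

open Complex Real ComplexConjugate

namespace Literature.NumberTheory.LFunctions.Zhang2022.Typed.Section15A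

open Literature.NumberTheory.LFunctions.Zhang2022.Skeleton

/-- `L₀ ≤ log D` once `D ≥ ⌈exp L₀⌉₊`. [folklore] -/
private theorem le_ell_of_ceil_exp_le_α {L₀ : ℝ} {D : ℕ} (hD : ⌈Real.exp L₀⌉₊ ≤ D) :
    L₀ ≤ ell D := by
  have h : Real.exp L₀ ≤ D := le_trans (Nat.le_ceil _) (by exact_mod_cast hD)
  exact (Real.le_log_iff_exp_le (lt_of_lt_of_le (Real.exp_pos _) h)).mpr h

/-- **Product rule for relative errors**: `‖A − M‖ ≤ a‖M‖`, `‖B − N‖ ≤ b‖N‖` imply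
`‖AB − MN‖ ≤ (a + b + ab)‖MN‖`. [folklore] -/
private theorem norm_mul_sub_mul_le_rel {A B M N : ℂ} {a b : ℝ} (ha : ‖A - M‖ ≤ a * ‖M‖)
    (hb : ‖B - N‖ ≤ b * ‖N‖) : ‖A * B - M * N‖ ≤ (a + b + a * b) * ‖M * N‖ := by
  have ha0 : 0 ≤ a * ‖M‖ := le_trans (norm_nonneg _) ha
  have hb0 : 0 ≤ b * ‖N‖ := le_trans (norm_nonneg _) hb
  have e : A * B - M * N = (A - M) * N + M * (B - N) + (A - M) * (B - N) := by ring
  rw [e]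
  calc ‖(A - M) * N + M * (B - N) + (A - M) * (B - N)‖
      ≤ ‖(A - M) * N + M * (B - N)‖ + ‖(A - M) * (B - N)‖ := norm_add_le _ _
    _ ≤ ‖(A - M) * N‖ + ‖M * (B - N)‖ + ‖(A - M) * (B - N)‖ := by
        gcongr; exact norm_add_le _ _
    _ = ‖A - M‖ * ‖N‖ + ‖M‖ * ‖B - N‖ + ‖A - M‖ * ‖B - N‖ := by
        rw [norm_mul, norm_mul, norm_mul]
    _ ≤ a * ‖M‖ * ‖N‖ + ‖M‖ * (b * ‖N‖) + a * ‖M‖ * (b * ‖N‖) := by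
        gcongr
    _ = (a + b + a * b) * ‖M * N‖ := by rw [norm_mul]; ring

/-- On `𝔍(z)` one has `e^{−π·Im s} ≤ 𝓛⁻¹²³` once `𝓛 ≥ 9` (`Im s ≥ 5𝓛⁵¹⁹`, `𝓛¹²³ ≤ e^{123𝓛}`).
[cite: Zhang2022LandauSiegel, §15 p. 80] -/
theorem exp_neg_pi_im_le_of_memJ {D : ℕ} (hL : 9 ≤ ell D) {z : ℝ} {s : ℂ} (hs : MemJ D z s) :
    Real.exp (-π * s.im) ≤ (ell D ^ 123)⁻¹ := by
  have hL1 : 1 ≤ ell D := by linarith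
  have hL0 : 0 < ell D := by linarith
  have ht : 5 * ell D ^ 519 ≤ s.im := five_mul_le_im_of_memJ hL1 hs
  -- `𝓛¹²³ ≤ exp(123𝓛)`
  have h1 : ell D ^ 123 ≤ Real.exp (123 * ell D) := by
    have hx : ell D ≤ Real.exp (ell D) := by linarith [Real.add_one_le_exp (ell D)]
    calc ell D ^ 123 ≤ Real.exp (ell D) ^ 123 := pow_le_pow_left₀ hL0.le hx 123
      _ = Real.exp (123 * ell D) := by rw [← Real.exp_nat_mul]; norm_num
  -- `123𝓛 ≤ π·Im s`
  have h2 : 123 * ell D ≤ π * s.im := by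
    have h519 : ell D ^ 2 ≤ ell D ^ 519 := pow_le_pow_right₀ hL1 (by norm_num)
    have hsq : 9 * ell D ≤ ell D ^ 2 := by nlinarith
    have hπ : 3 * (5 * ell D ^ 519) ≤ π * s.im :=
      mul_le_mul Real.pi_gt_three.le ht (by positivity) Real.pi_pos.le
    nlinarith
  have hpos : 0 < ell D ^ 123 := by positivity
  rw [show -π * s.im = -(π * s.im) by ring, Real.exp_neg]
  exact inv_anti₀ hpos (h1.trans (Real.exp_le_exp.mpr h2))

/-- **Z22:§15.u008, part (α) DISCHARGED** — the pointwise rewriting of `𝔨₁(s,ψ)` on `𝔍(−α)`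
(§15 p. 80, tex L4017–L4033, "Hence"): for every `c′` there is `C` with, for all large `D`, every
real primitive `χ (mod D)`, `ψ ∈ Ψ₁` and `s ∈ 𝔍(−α)`,
`‖𝔨₁(s,ψ) − τ(χ)χ(p)ψ̄(D)(pt₀)^{−β₃}D^{s−1}·[L(1−s−β₁,ψ̄)L(1−s−β₂,ψ̄)/L(1−s,ψ̄)]·B(s,ψ)K(1−s−β₃,ψ̄)‖
≤ C𝓛⁻¹²³·‖(the same main term)‖` — u004 (`step15_u004_holds`) ∘ u006 (`step15_u006_holds`), the
`O(e^{−πt})` of u006 absorbed by `e^{−πt} ≤ 𝓛⁻¹²³`. [cite: Zhang2022LandauSiegel, §15 p. 80] -/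
theorem step15_u008alpha_holds (c' : ℝ) :
    ∃ C : ℝ, ForAllLarge fun D _ χ => ∀ x ∈ PsiOne χ, ∀ s : ℂ, MemJ D (-alpha D) s →
      ‖frakk1 c' χ x s -
          GammaFactor.tau χ * χ (x.p : ZMod D) * conj (x.ψ (D : ZMod x.p)) *
            (((x.p : ℝ) * t0 D : ℝ) : ℂ) ^ (-beta3 c' D) * (D : ℂ) ^ (s - 1) *
            (x.ψ⁻¹.LFunction (1 - s - beta1 c' D) * x.ψ⁻¹.LFunction (1 - s - beta2 c' D) /
              x.ψ⁻¹.LFunction (1 - s)) *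
            Bpoly χ x s * Kchar D (psiBarFn x) (1 - s - beta3 c' D)‖ ≤
        C * (ell D ^ 123)⁻¹ *
          ‖GammaFactor.tau χ * χ (x.p : ZMod D) * conj (x.ψ (D : ZMod x.p)) *
            (((x.p : ℝ) * t0 D : ℝ) : ℂ) ^ (-beta3 c' D) * (D : ℂ) ^ (s - 1) *
            (x.ψ⁻¹.LFunction (1 - s - beta1 c' D) * x.ψ⁻¹.LFunction (1 - s - beta2 c' D) /
              x.ψ⁻¹.LFunction (1 - s)) *
            Bpoly χ x s * Kchar D (psiBarFn x) (1 - s - beta3 c' D)‖ := by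
  obtain ⟨C₄, h4⟩ := step15_u004_holds c'
  obtain ⟨C₆, h6⟩ := step15_u006_holds
  obtain ⟨D₁, h46⟩ := h4.and h6
  set a₀ : ℝ := max C₄ 0 with ha₀
  set b₀ : ℝ := max C₆ 0 with hb₀
  refine ⟨a₀ + b₀ + a₀ * b₀, ForAllLarge.of_le (max D₁ (max 3 ⌈Real.exp 9⌉₊)) ?_⟩
  intro D _ χ hD hq hχ x hx s hs
  have hD₁ : D₁ ≤ D := le_trans (le_max_left _ _) hD
  have hD3 : 3 ≤ D := le_trans (le_trans (le_max_left _ _) (le_max_right _ _)) hD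
  have hL9 : 9 ≤ ell D :=
    le_ell_of_ceil_exp_le_α (le_trans (le_trans (le_max_right _ _) (le_max_right _ _)) hD)
  have hL0 : 0 < ell D := by linarith
  obtain ⟨h4D, h6D⟩ := h46 D χ hD₁ hq hχ
  have hA := h4D x hx s hs
  have hB := h6D x hx s hs
  simp only at hA hB
  -- names
  set Z : ℂ := GammaFactor.Zfac x.ψ s with hZ
  set Zp : ℂ := Zpc χ x s with hZp
  set R : ℂ := x.ψ.LFunction (s + beta1 c' D) * x.ψ.LFunction (s + beta2 c' D) /
    x.ψ.LFunction s with hR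
  set RR : ℂ := x.ψ⁻¹.LFunction (1 - s - beta1 c' D) * x.ψ⁻¹.LFunction (1 - s - beta2 c' D) /
    x.ψ⁻¹.LFunction (1 - s) with hRR
  set Pw : ℂ := (((x.p : ℝ) * t0 D : ℝ) : ℂ) ^ (-beta3 c' D) with hPw
  set M6 : ℂ := GammaFactor.tau χ * χ (x.p : ZMod D) * conj (x.ψ (D : ZMod x.p)) *
    (D : ℂ) ^ (s - 1) with hM6
  set BK : ℂ := Bpoly χ x s * Kchar D (psiBarFn x) (1 - s - beta3 c' D) with hBK
  -- `Z(s,ψ) ≠ 0`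
  have him : 0 < s.im := lt_of_lt_of_le one_pos (one_le_im_of_memJ hD3 hs)
  have hZ0 : Z ≠ 0 := GammaFactor.Zfac_ne_zero x.prim him
  -- the two relative errors, both at scale `ε = 𝓛⁻¹²³`
  set ε : ℝ := (ell D ^ 123)⁻¹ with hε
  have hε0 : 0 ≤ ε := by rw [hε]; positivity
  have hε1 : ε ≤ 1 := by rw [hε]; exact inv_le_one_of_one_le₀ (one_le_pow₀ (by linarith))
  have ha₀0 : 0 ≤ a₀ := le_max_right _ _
  have hb₀0 : 0 ≤ b₀ := le_max_right _ _
  have ha : ‖R / Z - Pw * RR‖ ≤ a₀ * ε * ‖Pw * RR‖ := by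
    have hZn : 0 < ‖Z‖ := norm_pos_iff.mpr hZ0
    have e1 : ‖R / Z - Pw * RR‖ = ‖R - Pw * Z * RR‖ / ‖Z‖ := by
      rw [← norm_div]; congr 1; field_simp
    have e2 : ‖Pw * RR‖ = ‖Pw * Z * RR‖ / ‖Z‖ := by
      rw [← norm_div]; congr 1; field_simp
    have hA' : ‖R - Pw * Z * RR‖ ≤ a₀ * ε * ‖Pw * Z * RR‖ := by
      calc ‖R - Pw * Z * RR‖ ≤ C₄ * (ell D ^ 123)⁻¹ * ‖Pw * Z * RR‖ := hA
        _ ≤ a₀ * ε * ‖Pw * Z * RR‖ := by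
            apply mul_le_mul_of_nonneg_right _ (norm_nonneg _)
            rw [hε]
            exact mul_le_mul_of_nonneg_right (le_max_left _ _) (by positivity)
    rw [e1, e2, show a₀ * ε * (‖Pw * Z * RR‖ / ‖Z‖) = (a₀ * ε * ‖Pw * Z * RR‖) / ‖Z‖ by ring]
    exact div_le_div_of_nonneg_right hA' (norm_nonneg _)
  have hexp : Real.exp (-π * s.im) ≤ (ell D ^ 123)⁻¹ := exp_neg_pi_im_le_of_memJ hL9 hs
  have hb : ‖Z / Zp - M6‖ ≤ b₀ * ε * ‖M6‖ := by
    calc ‖Z / Zp - M6‖ ≤ C₆ * Real.exp (-π * s.im) * ‖M6‖ := hB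
      _ ≤ b₀ * Real.exp (-π * s.im) * ‖M6‖ := by
          gcongr; exact le_max_left _ _
      _ ≤ b₀ * ε * ‖M6‖ := by rw [hε]; gcongr
  -- combine
  have hprod := norm_mul_sub_mul_le_rel hb ha
  have hcoef : b₀ * ε + a₀ * ε + b₀ * ε * (a₀ * ε) ≤ (a₀ + b₀ + a₀ * b₀) * ε := by
    have h1 : b₀ * ε * (a₀ * ε) ≤ a₀ * b₀ * ε := by
      have : ε * ε ≤ ε * 1 := mul_le_mul_of_nonneg_left hε1 hε0
      nlinarith [mul_nonneg ha₀0 hb₀0]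
    nlinarith
  -- `𝔨₁ = (Z/Zp)·(R/Z)·B·K` and `M₁ = M6·(Pw·RR)·B·K`
  have hfrakk : frakk1 c' χ x s = (Z / Zp) * (R / Z) * BK := by
    have hzz : Z / Zp * (R / Z) = R / Zp := by
      calc Z / Zp * (R / Z) = (R * Z) / (Zp * Z) := by rw [div_mul_div_comm]; ring
        _ = R / Zp := mul_div_mul_right R Zp hZ0
    rw [hzz, frakk1, ← hZp, ← hR, hBK, div_eq_mul_inv R Zp]
    ring
  have hM1 : GammaFactor.tau χ * χ (x.p : ZMod D) * conj (x.ψ (D : ZMod x.p)) *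
        (((x.p : ℝ) * t0 D : ℝ) : ℂ) ^ (-beta3 c' D) * (D : ℂ) ^ (s - 1) *
        (x.ψ⁻¹.LFunction (1 - s - beta1 c' D) * x.ψ⁻¹.LFunction (1 - s - beta2 c' D) /
          x.ψ⁻¹.LFunction (1 - s)) *
        Bpoly χ x s * Kchar D (psiBarFn x) (1 - s - beta3 c' D) = M6 * (Pw * RR) * BK := by
    rw [hM6, hPw, hRR, hBK]; ring
  rw [hfrakk, hM1, ← sub_mul, norm_mul, norm_mul (M6 * (Pw * RR)) BK]
  calc ‖Z / Zp * (R / Z) - M6 * (Pw * RR)‖ * ‖BK‖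
      ≤ (b₀ * ε + a₀ * ε + b₀ * ε * (a₀ * ε)) * ‖M6 * (Pw * RR)‖ * ‖BK‖ := by
        gcongr
    _ ≤ ((a₀ + b₀ + a₀ * b₀) * ε) * ‖M6 * (Pw * RR)‖ * ‖BK‖ := by
        gcongr
    _ = (a₀ + b₀ + a₀ * b₀) * (ell D ^ 123)⁻¹ * (‖M6 * (Pw * RR)‖ * ‖BK‖) := by
        rw [hε]; ring

end Literature.NumberTheory.LFunctions.Zhang2022.Typed.Section15A
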